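import Mathlib.Analysis.SpecialFunctions.Log.Basic
import Mathlib.Algebra.Order.BigOperators.Group.Finset
import Mathlib.Algebra.BigOperators.Ring.Finset
import HarnessLib

/-!
# [IUTchIV] Theorem 1.10, Step (ii): the local-to-global assembly of the log-different estimates

Mochizuki, *Inter-universal Teichmüller theory IV*, RIMS manuscript (Apr. 2020; = PRIMS **57** (2021)),
proof of Thm. 1.10, Step (ii), p. 24:

> "(ii) Next, let us observe that the inequality `log(𝔡^{F_tpd}) + log(𝔣^{F_tpd}) ≤ log(𝔡^F) + log(𝔣^F)`
> follows immediately from Proposition 1.3, (i), and the various definitions involved. On the other hand,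
> the inequality `log(𝔡^F) + log(𝔣^F) ≤ log(𝔡^{F_tpd}) + log(𝔣^{F_tpd}) + log(2^11·3^3·5^2) ≤ … + 21` follows by
> applying Proposition 1.3, (i), at the primes that do not divide `2·3·5` [where we recall that the
> extension `F/F_tpd` is tamely ramified over such primes — cf. Proposition 1.8, (vi), (vii)] and applying
> Proposition 1.3, (ii), together with (E3), (E4), (E5), (E6), and the fact that we have a natural outer
> inclusion `Gal(F/F_tpd) ↪ GL_2(𝔽_3) × GL_2(𝔽_5) × ℤ/2ℤ`, at the primes that divide `2·3·5`. In a similar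
> vein, since the extension `K/F` is tamely ramified at the primes that do not divide `l`, and we have a
> natural outer inclusion `Gal(K/F) ↪ GL_2(𝔽_l)`, the inequality `log(𝔡^K) ≤ log(𝔡^K) + log(𝔣^K) ≤
> log(𝔡^F) + log(𝔣^F) + 2·log(l)` follows immediately from Proposition 1.3, (i), (ii)."

This file kernel-checks the ASSEMBLY of these three displays from per-place inputs, in the style of
`Theorem110LocalBounds.lean` (Step (v)): an extension `L/L₀` of number fields is seen through finitely many
nonarchimedean places — per place `v` of `L₀`: residue characteristic `p_v`, absolute ramification index
`e_v`, residue degree `f_v`, different exponent `d_v` (normalised by `ord(p_v) = 1`, as in Props. 1.1–1.3),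
and whether the curve has bad multiplicative reduction at `v`; per place `w | v` of `L`: `e_{w/v}`, `f_{w/v}`,
`d_w`; with the fundamental identity `Σ_{w|v} e_{w/v} f_{w/v} = [L:L₀]` (`PlaceData`). The global quantities
are `log(𝔡) = (1/[L:ℚ])·Σ_w [L_w:ℚ_p]·d_w·log p` and `log(𝔣) = (1/[L:ℚ])·Σ_{w bad} f_w·log p` ([IUTchIV]
Def. 1.9 / [GenEll] Def. 1.5; finitely many places carry nonzero terms). PROVED:
* `first_display` — Prop. 1.3 (i) at every `w | v` (`d_w ≥ d_v + (e_{w/v} − 1)/e_w`) ⟹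
  `log(𝔡^{L₀}) + log(𝔣^{L₀}) ≤ log(𝔡^L) + log(𝔣^L)`: the gain in the different, `f_w(e_{w/v} − 1)·log p` per
  `w`, EXACTLY compensates the loss in the normalised conductor at the bad places;
* `second_display` — outside a set `S` of places: tame equality of Prop. 1.3 (i) at bad places and
  "unramified" (`e_{w/v} = 1`, `d_w = d_v`) at good places (Prop. 1.8 (vi)(vii), (D0)); at `v ∈ S`: Prop. 1.3
  (ii) in the form `d_w ≤ d_v + c_v` ⟹ `log(𝔡^L) + log(𝔣^L) ≤ log(𝔡^{L₀}) + log(𝔣^{L₀}) + (1/[L:ℚ])·Σ_{v∈S}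
  Σ_{w|v} [L_w:ℚ_p]·c_v·log p_v`;
* `special_sum_le` — with `S` = the places over a finite set `P` of rational primes, `c_v = c(p_v)` and
  `Σ_{w | q} [L_w:ℚ_q] ≤ [L:ℚ]`: that last term is `≤ Σ_{q∈P} c(q)·log q`;
* the printed constants: `log_F_const` (`11·log 2 + 3·log 3 + 2·log 5 = log(2^11·3^3·5^2)`, from
  `n_w + 1/e_v ≤ ord_p(2^10·3^2·5) + 1`, `|GL_2(𝔽_3)|·|GL_2(𝔽_5)|·2 = 2^10·3^2·5` by (E3)(E4)) and `2·log(l)`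
  (`|GL_2(𝔽_l)| = l(l+1)(l−1)^2` has `l`-part `l`);
so that the fields `tpd_le_F`, `F_le`, `K_le` of `Thm110Numerics.ProofData` (`Theorem110Data.lean`) are
reduced to per-place Prop. 1.3 / Prop. 1.8-shaped inputs. Those inputs themselves (Prop. 1.3 for actual
`p`-adic fields: `DifferentEstimates.lean`; Prop. 1.8) are NOT proved here; nothing on Cor. 3.12.
-/

noncomputable section

namespace Literature.IUT.LogVolume

namespace Thm110StepII

open Finset Real

variable {V : Type*} [Fintype V] {W : V → Type*} [∀ v, Fintype (W v)]

/-- An extension `L/L₀` of number fields seen through finitely many places: per place `v` of `L₀` the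
residue characteristic `p_v`, `e_v`, `f_v`, the normalised different exponent `d_v ≥ 0`, bad (multiplicative)
reduction or not; per place `w | v` of `L`: `e_{w/v}`, `f_{w/v}`, `d_w`; `[L₀:ℚ]`, `n = [L:L₀]`, and the
fundamental identity `Σ_{w|v} e_{w/v}·f_{w/v} = n`. [claim: Mochizuki2012, status: disputed] -/
structure PlaceData (V : Type*) [Fintype V] (W : V → Type*) [∀ v, Fintype (W v)] where
  /-- `[L₀ : ℚ]` -/
  deg0 : ℝ
  /-- `[L₀ : ℚ] > 0` -/
  deg0_pos : 0 < deg0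
  /-- `n = [L : L₀]` -/
  n : ℕ
  /-- `n ≥ 1` -/
  n_pos : 0 < n
  /-- residue characteristic of `v` -/
  p : V → ℕ
  /-- it is `≥ 2` -/
  two_le_p : ∀ v, 2 ≤ p v
  /-- absolute ramification index `e_v` of `(L₀)_v / ℚ_p` -/
  e0 : V → ℕ
  /-- `e_v ≥ 1` -/
  e0_pos : ∀ v, 0 < e0 v
  /-- absolute residue degree `f_v` -/
  f0 : V → ℕ
  /-- `f_v ≥ 1` -/
  f0_pos : ∀ v, 0 < f0 v
  /-- different exponent of `(L₀)_v / ℚ_p`, normalised by `ord(p) = 1` -/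
  d0 : V → ℝ
  /-- `d_v ≥ 0` -/
  d0_nonneg : ∀ v, 0 ≤ d0 v
  /-- bad multiplicative reduction at `v` (the conductor is supported here) -/
  bad : V → Bool
  /-- relative ramification index `e_{w/v}` -/
  erel : ∀ v, W v → ℕ
  /-- `e_{w/v} ≥ 1` -/
  erel_pos : ∀ v w, 0 < erel v w
  /-- relative residue degree `f_{w/v}` -/
  frel : ∀ v, W v → ℕ
  /-- `f_{w/v} ≥ 1` -/
  frel_pos : ∀ v w, 0 < frel v w
  /-- different exponent of `L_w / ℚ_p`, normalised by `ord(p) = 1` -/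
  d : ∀ v, W v → ℝ
  /-- the fundamental identity `Σ_{w|v} e_{w/v} f_{w/v} = [L : L₀]` -/
  fund : ∀ v, ∑ w, erel v w * frel v w = n

namespace PlaceData

variable (T : PlaceData V W)

/-- `[L : ℚ] = n·[L₀ : ℚ]`. [claim: Mochizuki2012, status: disputed] -/
def deg : ℝ := T.n * T.deg0

/-- `log p_v`. [claim: Mochizuki2012, status: disputed] -/
def logp (v : V) : ℝ := Real.log (T.p v)

/-- local degree `[L_w : ℚ_p] = e_v e_{w/v} f_v f_{w/v}`. [claim: Mochizuki2012, status: disputed] -/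
def locdeg (v : V) (w : W v) : ℝ := (T.e0 v * T.erel v w : ℕ) * (T.f0 v * T.frel v w : ℕ)

/-- `log(𝔡^{L₀}) = (1/[L₀:ℚ])·Σ_v e_v f_v·d_v·log p_v`. [claim: Mochizuki2012, status: disputed] -/
def logDiff0 : ℝ := (1 / T.deg0) * ∑ v, ((T.e0 v * T.f0 v : ℕ) : ℝ) * T.d0 v * T.logp v

/-- `log(𝔣^{L₀}) = (1/[L₀:ℚ])·Σ_{v bad} f_v·log p_v`. [claim: Mochizuki2012, status: disputed] -/
def logCond0 : ℝ := (1 / T.deg0) * ∑ v, if T.bad v then (T.f0 v : ℝ) * T.logp v else 0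

/-- `log(𝔡^L) = (1/[L:ℚ])·Σ_v Σ_{w|v} [L_w:ℚ_p]·d_w·log p_v`. [claim: Mochizuki2012, status: disputed] -/
def logDiff : ℝ := (1 / T.deg) * ∑ v, ∑ w, T.locdeg v w * T.d v w * T.logp v

/-- `log(𝔣^L) = (1/[L:ℚ])·Σ_{v bad} Σ_{w|v} f_v f_{w/v}·log p_v`. [claim: Mochizuki2012, status: disputed] -/
def logCond : ℝ := (1 / T.deg) * ∑ v, if T.bad v then ∑ w, ((T.f0 v * T.frel v w : ℕ) : ℝ) * T.logp v else 0

/-! ### Elementary facts -/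

/-- `[L:ℚ] > 0`. [folklore] -/
private theorem deg_pos : 0 < T.deg := mul_pos (by exact_mod_cast T.n_pos) T.deg0_pos

/-- `log p_v ≥ 0`. [folklore] -/
private theorem logp_nonneg (v : V) : 0 ≤ T.logp v :=
  Real.log_nonneg (by have := T.two_le_p v; exact_mod_cast (by omega : 1 ≤ T.p v))

/-- The fundamental identity over `ℝ`. [folklore] -/
private theorem fund_real (v : V) : ∑ w, ((T.erel v w : ℝ) * T.frel v w) = T.n := by
  have := T.fund v
  exact_mod_cast this

/-- `Σ_{w|v} f_{w/v} ≤ n` (since `e_{w/v} ≥ 1`). [folklore] -/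
private theorem sum_frel_le (v : V) : ∑ w, (T.frel v w : ℝ) ≤ T.n := by
  rw [← T.fund_real v]
  refine Finset.sum_le_sum fun w _ => ?_
  have he : (1 : ℝ) ≤ T.erel v w := by exact_mod_cast T.erel_pos v w
  have hf : (0 : ℝ) ≤ T.frel v w := Nat.cast_nonneg _
  nlinarith

/-- The per-place term of `[L:ℚ]·(log(𝔡^L) + log(𝔣^L))`. [claim: Mochizuki2012, status: disputed] -/
def topTerm (v : V) : ℝ :=
  ∑ w, T.locdeg v w * T.d v w * T.logp v +
    if T.bad v then ∑ w, ((T.f0 v * T.frel v w : ℕ) : ℝ) * T.logp v else 0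

/-- The per-place term of `[L:ℚ]·(log(𝔡^{L₀}) + log(𝔣^{L₀}))` (i.e. `n` times the `L₀`-term).
[claim: Mochizuki2012, status: disputed] -/
def botTerm (v : V) : ℝ :=
  T.n * (((T.e0 v * T.f0 v : ℕ) : ℝ) * T.d0 v * T.logp v + if T.bad v then (T.f0 v : ℝ) * T.logp v else 0)

/-- `[L:ℚ]·(log(𝔡^L) + log(𝔣^L)) = Σ_v topTerm`. [claim: Mochizuki2012, status: disputed] -/
theorem deg_mul_top : T.deg * (T.logDiff + T.logCond) = ∑ v, T.topTerm v := by
  unfold logDiff logCond topTerm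
  have hd := T.deg_pos
  rw [Finset.sum_add_distrib]
  field_simp

/-- `[L:ℚ]·(log(𝔡^{L₀}) + log(𝔣^{L₀})) = Σ_v botTerm`. [claim: Mochizuki2012, status: disputed] -/
theorem deg_mul_bot : T.deg * (T.logDiff0 + T.logCond0) = ∑ v, T.botTerm v := by
  have hsum : ∑ v, T.botTerm v = T.n * ((∑ v, ((T.e0 v * T.f0 v : ℕ) : ℝ) * T.d0 v * T.logp v) +
      ∑ v, if T.bad v then (T.f0 v : ℝ) * T.logp v else 0) := by
    unfold botTerm
    rw [← Finset.sum_add_distrib, Finset.mul_sum]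
  rw [hsum]
  unfold logDiff0 logCond0 deg
  have hd := T.deg0_pos.ne'
  rw [← mul_add]
  field_simp

/-- The value of `Σ_w [L_w:ℚ_p]·(d_v + (e_{w/v}−1)/(e_{w/v} e_v))`: it is `n·e_v f_v·d_v + f_v·Σ_w f_{w/v}(e_{w/v} − 1)`.
[claim: Mochizuki2012, status: disputed] -/
theorem sum_locdeg_tame (v : V) :
    ∑ w, T.locdeg v w * (T.d0 v + ((T.erel v w : ℝ) - 1) / (T.erel v w * T.e0 v)) =
      T.n * ((T.e0 v * T.f0 v : ℕ) : ℝ) * T.d0 v + T.f0 v * ∑ w, (T.frel v w : ℝ) * ((T.erel v w : ℝ) - 1) := by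
  have hterm : ∀ w, T.locdeg v w * (T.d0 v + ((T.erel v w : ℝ) - 1) / (T.erel v w * T.e0 v)) =
      ((T.e0 v * T.f0 v : ℕ) : ℝ) * T.d0 v * ((T.erel v w : ℝ) * T.frel v w) +
        T.f0 v * ((T.frel v w : ℝ) * ((T.erel v w : ℝ) - 1)) := by
    intro w
    unfold locdeg
    have he : (T.erel v w : ℝ) ≠ 0 := by exact_mod_cast (T.erel_pos v w).ne'
    have he0 : (T.e0 v : ℝ) ≠ 0 := by exact_mod_cast (T.e0_pos v).ne'
    push_cast
    field_simp
  simp_rw [hterm]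
  rw [Finset.sum_add_distrib, ← Finset.mul_sum, ← Finset.mul_sum, T.fund_real]
  ring

/-! ### The first display: `log(𝔡^{L₀}) + log(𝔣^{L₀}) ≤ log(𝔡^L) + log(𝔣^L)` -/

/-- Per place: Prop. 1.3 (i) at every `w | v` gives `botTerm v ≤ topTerm v`. [claim: Mochizuki2012, status: disputed] -/
theorem botTerm_le_topTerm (v : V)
    (h13i : ∀ w, T.d0 v + ((T.erel v w : ℝ) - 1) / (T.erel v w * T.e0 v) ≤ T.d v w) :
    T.botTerm v ≤ T.topTerm v := by
  have hlp := T.logp_nonneg v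
  -- the different part
  have hdiff : (T.n * ((T.e0 v * T.f0 v : ℕ) : ℝ) * T.d0 v +
      T.f0 v * ∑ w, (T.frel v w : ℝ) * ((T.erel v w : ℝ) - 1)) * T.logp v ≤
      ∑ w, T.locdeg v w * T.d v w * T.logp v := by
    rw [← T.sum_locdeg_tame v, Finset.sum_mul]
    refine Finset.sum_le_sum fun w _ => ?_
    have hl : 0 ≤ T.locdeg v w := by unfold locdeg; positivity
    exact mul_le_mul_of_nonneg_right (mul_le_mul_of_nonneg_left (h13i w) hl) hlp
  -- the compensation `f_v·Σ_w f_{w/v}(e_{w/v} − 1) ≥ 0`, and `= n f_v − Σ_w f_v f_{w/v}` exactly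
  have hcomp : (T.f0 v : ℝ) * ∑ w, (T.frel v w : ℝ) * ((T.erel v w : ℝ) - 1) =
      T.n * T.f0 v - ∑ w, ((T.f0 v * T.frel v w : ℕ) : ℝ) := by
    rw [← T.fund_real v, Finset.mul_sum, Finset.sum_mul, ← Finset.sum_sub_distrib]
    refine Finset.sum_congr rfl fun w _ => ?_
    push_cast; ring
  have hcomp_nonneg : 0 ≤ (T.f0 v : ℝ) * ∑ w, (T.frel v w : ℝ) * ((T.erel v w : ℝ) - 1) := by
    refine mul_nonneg (Nat.cast_nonneg _) (Finset.sum_nonneg fun w _ => mul_nonneg (Nat.cast_nonneg _) ?_)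
    have : (1 : ℝ) ≤ T.erel v w := by exact_mod_cast T.erel_pos v w
    linarith
  unfold botTerm topTerm
  cases hb : T.bad v
  · simp only [Bool.false_eq_true, ↓reduceIte, add_zero]
    nlinarith
  · simp only [↓reduceIte]
    rw [hcomp] at hdiff
    have hs : ∑ w, ((T.f0 v * T.frel v w : ℕ) : ℝ) * T.logp v =
        (∑ w, ((T.f0 v * T.frel v w : ℕ) : ℝ)) * T.logp v := by rw [Finset.sum_mul]
    rw [hs]
    nlinarith

/-- **Step (ii), first display**: Prop. 1.3 (i) at every place ⟹
`log(𝔡^{L₀}) + log(𝔣^{L₀}) ≤ log(𝔡^L) + log(𝔣^L)` (for `F/F_tpd`: `ProofData.tpd_le_F`).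
[claim: Mochizuki2012, status: disputed] -/
theorem first_display
    (h13i : ∀ v w, T.d0 v + ((T.erel v w : ℝ) - 1) / (T.erel v w * T.e0 v) ≤ T.d v w) :
    T.logDiff0 + T.logCond0 ≤ T.logDiff + T.logCond := by
  have hd := T.deg_pos
  have h : T.deg * (T.logDiff0 + T.logCond0) ≤ T.deg * (T.logDiff + T.logCond) := by
    rw [deg_mul_top, deg_mul_bot]
    exact Finset.sum_le_sum fun v _ => T.botTerm_le_topTerm v (h13i v)
  exact le_of_mul_le_mul_left h hd

/-! ### The second display: tame / unramified outside `S`, Prop. 1.3 (ii) on `S` -/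

/-- Per place outside `S`, bad (tame: Prop. 1.3 (i) is an EQUALITY): `topTerm v = botTerm v`.
[claim: Mochizuki2012, status: disputed] -/
theorem topTerm_eq_of_tame (v : V) (hb : T.bad v = true)
    (htame : ∀ w, T.d v w = T.d0 v + ((T.erel v w : ℝ) - 1) / (T.erel v w * T.e0 v)) :
    T.topTerm v = T.botTerm v := by
  unfold topTerm botTerm
  simp only [hb, ↓reduceIte]
  have h1 : ∑ w, T.locdeg v w * T.d v w * T.logp v =
      (T.n * ((T.e0 v * T.f0 v : ℕ) : ℝ) * T.d0 v +
        T.f0 v * ∑ w, (T.frel v w : ℝ) * ((T.erel v w : ℝ) - 1)) * T.logp v := by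
    rw [← T.sum_locdeg_tame v, Finset.sum_mul]
    refine Finset.sum_congr rfl fun w _ => ?_
    rw [htame w]
  have hcomp : (T.f0 v : ℝ) * ∑ w, (T.frel v w : ℝ) * ((T.erel v w : ℝ) - 1) =
      T.n * T.f0 v - ∑ w, ((T.f0 v * T.frel v w : ℕ) : ℝ) := by
    rw [← T.fund_real v, Finset.mul_sum, Finset.sum_mul, ← Finset.sum_sub_distrib]
    refine Finset.sum_congr rfl fun w _ => ?_
    push_cast; ring
  rw [h1, hcomp]
  have : ∑ w, ((T.f0 v * T.frel v w : ℕ) : ℝ) * T.logp v = (∑ w, ((T.f0 v * T.frel v w : ℕ) : ℝ)) * T.logp v := by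
    rw [Finset.sum_mul]
  rw [this]
  ring

/-- Per place outside `S`, good (unramified: `e_{w/v} = 1`, `d_w = d_v`): `topTerm v = botTerm v`.
[claim: Mochizuki2012, status: disputed] -/
theorem topTerm_eq_of_unramified (v : V) (hb : T.bad v = false)
    (hunr : ∀ w, T.erel v w = 1 ∧ T.d v w = T.d0 v) : T.topTerm v = T.botTerm v := by
  unfold topTerm botTerm
  simp only [hb, Bool.false_eq_true, ↓reduceIte, add_zero]
  have hf : ∑ w, (T.frel v w : ℝ) = T.n := by
    rw [← T.fund_real v]
    refine Finset.sum_congr rfl fun w _ => ?_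
    rw [(hunr w).1]; push_cast; ring
  have : ∀ w, T.locdeg v w * T.d v w * T.logp v =
      ((T.e0 v * T.f0 v : ℕ) : ℝ) * T.d0 v * T.logp v * (T.frel v w : ℝ) := by
    intro w
    unfold locdeg
    rw [(hunr w).1, (hunr w).2]
    push_cast; ring
  simp_rw [this]
  rw [← Finset.mul_sum, hf]
  ring

/-- Per place in `S` (Prop. 1.3 (ii) in the form `d_w ≤ d_v + c_v`):
`topTerm v ≤ botTerm v + Σ_w [L_w:ℚ_p]·c_v·log p_v`. [claim: Mochizuki2012, status: disputed] -/
theorem topTerm_le_of_special (v : V) {c : ℝ} (hS : ∀ w, T.d v w ≤ T.d0 v + c) :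
    T.topTerm v ≤ T.botTerm v + ∑ w, T.locdeg v w * c * T.logp v := by
  have hlp := T.logp_nonneg v
  have hdiff : ∑ w, T.locdeg v w * T.d v w * T.logp v ≤
      ∑ w, T.locdeg v w * (T.d0 v + c) * T.logp v := by
    refine Finset.sum_le_sum fun w _ => ?_
    have hl : 0 ≤ T.locdeg v w := by unfold locdeg; positivity
    exact mul_le_mul_of_nonneg_right (mul_le_mul_of_nonneg_left (hS w) hl) hlp
  have hsplit : ∑ w, T.locdeg v w * (T.d0 v + c) * T.logp v =
      T.n * ((T.e0 v * T.f0 v : ℕ) : ℝ) * T.d0 v * T.logp v + ∑ w, T.locdeg v w * c * T.logp v := by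
    have : ∀ w, T.locdeg v w * (T.d0 v + c) * T.logp v =
        ((T.e0 v * T.f0 v : ℕ) : ℝ) * T.d0 v * T.logp v * ((T.erel v w : ℝ) * T.frel v w) +
          T.locdeg v w * c * T.logp v := by
      intro w; unfold locdeg; push_cast; ring
    simp_rw [this]
    rw [Finset.sum_add_distrib, ← Finset.mul_sum, T.fund_real]
    ring
  have hcond : (if T.bad v then ∑ w, ((T.f0 v * T.frel v w : ℕ) : ℝ) * T.logp v else 0) ≤
      T.n * (if T.bad v then (T.f0 v : ℝ) * T.logp v else 0) := by
    cases T.bad v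
    · simp
    · simp only [↓reduceIte]
      have hs := T.sum_frel_le v
      have : ∑ w, ((T.f0 v * T.frel v w : ℕ) : ℝ) * T.logp v = (T.f0 v : ℝ) * T.logp v * ∑ w, (T.frel v w : ℝ) := by
        rw [Finset.mul_sum]
        refine Finset.sum_congr rfl fun w _ => ?_
        push_cast; ring
      rw [this]
      have hf0 : (0 : ℝ) ≤ T.f0 v := Nat.cast_nonneg _
      nlinarith [mul_nonneg hf0 hlp]
  unfold topTerm botTerm
  rw [mul_add]
  linarith

/-- **Step (ii), second display (general form)**: if outside `S` the extension is tame at bad places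
(Prop. 1.3 (i) with equality) and unramified at good places (Prop. 1.8 (vi)(vii), (D0)), and at `v ∈ S`
Prop. 1.3 (ii) gives `d_w ≤ d_v + c_v`, then
`log(𝔡^L) + log(𝔣^L) ≤ log(𝔡^{L₀}) + log(𝔣^{L₀}) + (1/[L:ℚ])·Σ_{v∈S} Σ_{w|v} [L_w:ℚ_p]·c_v·log p_v`.
[claim: Mochizuki2012, status: disputed] -/
theorem second_display (S : Finset V) (c : V → ℝ)
    (htame : ∀ v ∉ S, T.bad v = true → ∀ w, T.d v w = T.d0 v + ((T.erel v w : ℝ) - 1) / (T.erel v w * T.e0 v))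
    (hunr : ∀ v ∉ S, T.bad v = false → ∀ w, T.erel v w = 1 ∧ T.d v w = T.d0 v)
    (hS : ∀ v ∈ S, ∀ w, T.d v w ≤ T.d0 v + c v) :
    T.logDiff + T.logCond ≤ T.logDiff0 + T.logCond0 +
      (1 / T.deg) * ∑ v ∈ S, ∑ w, T.locdeg v w * c v * T.logp v := by
  classical
  have hd := T.deg_pos
  have hper : ∀ v, T.topTerm v ≤ T.botTerm v + if v ∈ S then ∑ w, T.locdeg v w * c v * T.logp v else 0 := by
    intro v
    by_cases hv : v ∈ S
    · rw [if_pos hv]; exact T.topTerm_le_of_special v (hS v hv)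
    · rw [if_neg hv, add_zero]
      cases hb : T.bad v
      · exact (T.topTerm_eq_of_unramified v hb (hunr v hv hb)).le
      · exact (T.topTerm_eq_of_tame v hb (htame v hv hb)).le
  have hsum : ∑ v, T.topTerm v ≤ ∑ v, T.botTerm v + ∑ v ∈ S, ∑ w, T.locdeg v w * c v * T.logp v := by
    calc ∑ v, T.topTerm v ≤ ∑ v, (T.botTerm v + if v ∈ S then ∑ w, T.locdeg v w * c v * T.logp v else 0) :=
          Finset.sum_le_sum fun v _ => hper v
      _ = ∑ v, T.botTerm v + ∑ v ∈ S, ∑ w, T.locdeg v w * c v * T.logp v := by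
          rw [Finset.sum_add_distrib, Finset.sum_ite_mem, Finset.univ_inter]
  rw [← deg_mul_top, ← deg_mul_bot] at hsum
  have : T.logDiff + T.logCond ≤ T.logDiff0 + T.logCond0 +
      (∑ v ∈ S, ∑ w, T.locdeg v w * c v * T.logp v) / T.deg := by
    rw [← sub_le_iff_le_add', le_div_iff₀ hd]
    nlinarith
  simpa [one_div, div_eq_inv_mul] using this

/-- **The special term over the places above a finite set `P` of rational primes**: if `S` consists of
places of residue characteristic in `P`, `c_v = c(p_v) ≥ 0`, and `Σ_{v∈S, p_v = q} Σ_{w|v} [L_w:ℚ_q] ≤ [L:ℚ]`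
for `q ∈ P` (the fundamental identity for `L/ℚ`), then
`(1/[L:ℚ])·Σ_{v∈S} Σ_w [L_w:ℚ_p]·c_v·log p_v ≤ Σ_{q∈P} c(q)·log q`. [claim: Mochizuki2012, status: disputed] -/
theorem special_sum_le (S : Finset V) (P : Finset ℕ) (cP : ℕ → ℝ) (hcP : ∀ q ∈ P, 0 ≤ cP q)
    (hSP : ∀ v ∈ S, T.p v ∈ P)
    (hfundQ : ∀ q ∈ P, ∑ v ∈ S.filter (fun v => T.p v = q), ∑ w, T.locdeg v w ≤ T.deg) :
    (1 / T.deg) * ∑ v ∈ S, ∑ w, T.locdeg v w * cP (T.p v) * T.logp v ≤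
      ∑ q ∈ P, cP q * Real.log q := by
  classical
  have hd := T.deg_pos
  -- regroup the sum over `S` by residue characteristic
  have hregroup : ∑ v ∈ S, ∑ w, T.locdeg v w * cP (T.p v) * T.logp v =
      ∑ q ∈ P, ∑ v ∈ S.filter (fun v => T.p v = q), ∑ w, T.locdeg v w * cP q * Real.log q := by
    rw [← Finset.sum_fiberwise_of_maps_to (g := T.p) (fun v hv => hSP v hv)]
    refine Finset.sum_congr rfl fun q _ => Finset.sum_congr rfl fun v hv => ?_
    rw [Finset.mem_filter] at hv
    unfold logp; rw [hv.2]
  rw [hregroup, Finset.mul_sum]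
  refine Finset.sum_le_sum fun q hq => ?_
  have hlq : 0 ≤ Real.log q := by
    rcases Nat.eq_zero_or_pos q with h | h
    · simp [h]
    · exact Real.log_nonneg (by exact_mod_cast h)
  have hinner : ∑ v ∈ S.filter (fun v => T.p v = q), ∑ w, T.locdeg v w * cP q * Real.log q =
      (∑ v ∈ S.filter (fun v => T.p v = q), ∑ w, T.locdeg v w) * (cP q * Real.log q) := by
    rw [Finset.sum_mul]
    refine Finset.sum_congr rfl fun v _ => ?_
    rw [Finset.sum_mul]
    refine Finset.sum_congr rfl fun w _ => ?_
    ring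
  rw [hinner, ← mul_assoc]
  have hc := mul_nonneg (hcP q hq) hlq
  calc 1 / T.deg * (∑ v ∈ S.filter (fun v => T.p v = q), ∑ w, T.locdeg v w) * (cP q * Real.log q)
      ≤ 1 / T.deg * T.deg * (cP q * Real.log q) := by
        refine mul_le_mul_of_nonneg_right ?_ hc
        exact mul_le_mul_of_nonneg_left (hfundQ q hq) (by positivity)
    _ = cP q * Real.log q := by field_simp

/-! ### The printed constants -/

/-- (E3)(E4): `|GL_2(𝔽_3)|·|GL_2(𝔽_5)|·|ℤ/2ℤ| = (3·2^4)·(5·2^5·3)·2 = 2^10·3^2·5`; with the `+1` of the term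
`1/e_0 ≤ 1` of Prop. 1.3 (ii) at each of `p = 2, 3, 5` the exponents become `11, 3, 2`:
`11·log 2 + 3·log 3 + 2·log 5 = log(2^11·3^3·5^2)`. [claim: Mochizuki2012, status: disputed] -/
theorem log_F_const :
    (3 * (3 + 1) * (3 - 1) ^ 2) * (5 * (5 + 1) * (5 - 1) ^ 2) * 2 = (2 ^ 10 * 3 ^ 2 * 5 : ℕ) ∧
    (11 : ℝ) * Real.log 2 + 3 * Real.log 3 + 2 * Real.log 5 = Real.log (2 ^ 11 * 3 ^ 3 * 5 ^ 2) := by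
  refine ⟨by norm_num, ?_⟩
  rw [Real.log_mul (by norm_num) (by norm_num), Real.log_mul (by norm_num) (by norm_num),
    Real.log_pow, Real.log_pow, Real.log_pow]
  push_cast
  ring

/-- The constant for `F/F_tpd` as a sum over `P = {2, 3, 5}` with `c(2) = 11`, `c(3) = 3`, `c(5) = 2`.
[claim: Mochizuki2012, status: disputed] -/
def cF : ℕ → ℝ := fun q => if q = 2 then 11 else if q = 3 then 3 else if q = 5 then 2 else 0

/-- `Σ_{q ∈ {2,3,5}} c_F(q)·log q = log(2^11·3^3·5^2)`. [claim: Mochizuki2012, status: disputed] -/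
theorem sum_cF : ∑ q ∈ ({2, 3, 5} : Finset ℕ), cF q * Real.log q = Real.log (2 ^ 11 * 3 ^ 3 * 5 ^ 2) := by
  rw [← log_F_const.2]
  simp [cF, Finset.sum_insert, Finset.sum_singleton]
  ring

/-- **Step (ii), second display for `F/F_tpd`**: `log(𝔡^F) + log(𝔣^F) ≤ log(𝔡^{F_tpd}) + log(𝔣^{F_tpd}) +
log(2^11·3^3·5^2)` from: tame at bad / unramified at good places not over `2·3·5` (Prop. 1.8 (vi)(vii)), and at
places over `p ∈ {2,3,5}`: `d_w ≤ d_v + c_F(p)` (Prop. 1.3 (ii): `n_w + 1/e_v ≤ ord_p(2^10·3^2·5) + 1`,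
`Gal(F/F_tpd) ↪ GL_2(𝔽_3) × GL_2(𝔽_5) × ℤ/2ℤ`), and `Σ_{w|p} [F_w:ℚ_p] ≤ [F:ℚ]`
(for `ProofData.F_le`). [claim: Mochizuki2012, status: disputed] -/
theorem second_display_F
    (htame : ∀ v, T.p v ∉ ({2, 3, 5} : Finset ℕ) → T.bad v = true →
      ∀ w, T.d v w = T.d0 v + ((T.erel v w : ℝ) - 1) / (T.erel v w * T.e0 v))
    (hunr : ∀ v, T.p v ∉ ({2, 3, 5} : Finset ℕ) → T.bad v = false → ∀ w, T.erel v w = 1 ∧ T.d v w = T.d0 v)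
    (h13ii : ∀ v, T.p v ∈ ({2, 3, 5} : Finset ℕ) → ∀ w, T.d v w ≤ T.d0 v + cF (T.p v))
    (hfundQ : ∀ q ∈ ({2, 3, 5} : Finset ℕ),
      ∑ v ∈ (Finset.univ.filter (fun v => T.p v ∈ ({2, 3, 5} : Finset ℕ))).filter (fun v => T.p v = q),
        ∑ w, T.locdeg v w ≤ T.deg) :
    T.logDiff + T.logCond ≤ T.logDiff0 + T.logCond0 + Real.log (2 ^ 11 * 3 ^ 3 * 5 ^ 2) := by
  classical
  set S : Finset V := Finset.univ.filter (fun v => T.p v ∈ ({2, 3, 5} : Finset ℕ)) with hSdef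
  have hmem : ∀ v, v ∈ S ↔ T.p v ∈ ({2, 3, 5} : Finset ℕ) := fun v => by simp [hSdef]
  have h2 := T.second_display S (fun v => cF (T.p v))
    (fun v hv hb => htame v (fun h => hv ((hmem v).mpr h)) hb)
    (fun v hv hb => hunr v (fun h => hv ((hmem v).mpr h)) hb)
    (fun v hv => h13ii v ((hmem v).mp hv))
  have h3 := T.special_sum_le S {2, 3, 5} cF (fun q _ => by unfold cF; split_ifs <;> norm_num)
    (fun v hv => (hmem v).mp hv) hfundQ
  rw [sum_cF] at h3
  exact h2.trans (add_le_add le_rfl h3)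

/-- The constant for `K/F`: `c(l) = 2` (`|GL_2(𝔽_l)| = l(l+1)(l−1)^2` has `l`-part `l^1`, plus `1/e ≤ 1`).
[claim: Mochizuki2012, status: disputed] -/
theorem GL2_card_l_part (l : ℕ) (hl : l.Prime) (h5 : 5 ≤ l) :
    l ∣ l * (l + 1) * (l - 1) ^ 2 ∧ ¬ l ^ 2 ∣ l * (l + 1) * (l - 1) ^ 2 := by
  refine ⟨⟨(l + 1) * (l - 1) ^ 2, by ring⟩, fun h => ?_⟩
  have hl1 : ¬ l ∣ (l + 1) := by
    intro hd
    have : l ∣ 1 := (Nat.dvd_add_right (dvd_refl l)).mp hd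
    exact hl.one_lt.ne' (Nat.dvd_one.mp this)
  have hl2 : ¬ l ∣ (l - 1) := by
    intro hd
    have hlt : l - 1 < l := Nat.sub_lt hl.pos one_pos
    have hpos : 0 < l - 1 := by omega
    exact absurd (Nat.le_of_dvd hpos hd) (not_le.mpr hlt)
  rw [pow_two, mul_assoc, Nat.mul_dvd_mul_iff_left hl.pos] at h
  rcases (Nat.Prime.dvd_mul hl).mp h with h' | h'
  · exact hl1 h'
  · exact hl2 ((Nat.Prime.dvd_of_dvd_pow hl) h')

/-- **Step (ii), third display for `K/F`**: `log(𝔡^K) + log(𝔣^K) ≤ log(𝔡^F) + log(𝔣^F) + 2·log(l)` from: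
tame at bad / unramified at good places not over `l`, `d_w ≤ d_v + 2` at places over `l` (Prop. 1.3 (ii):
`n_w + 1/e_v ≤ ord_l|GL_2(𝔽_l)| + 1 = 2`), and `Σ_{w|l} [K_w:ℚ_l] ≤ [K:ℚ]` (for `ProofData.K_le`).
[claim: Mochizuki2012, status: disputed] -/
theorem second_display_K (l : ℕ)
    (htame : ∀ v, T.p v ≠ l → T.bad v = true →
      ∀ w, T.d v w = T.d0 v + ((T.erel v w : ℝ) - 1) / (T.erel v w * T.e0 v))
    (hunr : ∀ v, T.p v ≠ l → T.bad v = false → ∀ w, T.erel v w = 1 ∧ T.d v w = T.d0 v)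
    (h13ii : ∀ v, T.p v = l → ∀ w, T.d v w ≤ T.d0 v + 2)
    (hfundQ : ∑ v ∈ Finset.univ.filter (fun v => T.p v = l), ∑ w, T.locdeg v w ≤ T.deg) :
    T.logDiff + T.logCond ≤ T.logDiff0 + T.logCond0 + 2 * Real.log l := by
  classical
  set S : Finset V := Finset.univ.filter (fun v => T.p v = l) with hSdef
  have hmem : ∀ v, v ∈ S ↔ T.p v = l := fun v => by simp [hSdef]
  have h2 := T.second_display S (fun _ => 2)
    (fun v hv hb => htame v (fun h => hv ((hmem v).mpr h)) hb)
    (fun v hv hb => hunr v (fun h => hv ((hmem v).mpr h)) hb)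
    (fun v hv => h13ii v ((hmem v).mp hv))
  have h3 := T.special_sum_le S {l} (fun _ => 2) (fun _ _ => by norm_num)
    (fun v hv => by rw [Finset.mem_singleton]; exact (hmem v).mp hv)
    (fun q hq => by
      rw [Finset.mem_singleton] at hq
      rw [hq, Finset.filter_true_of_mem (fun v hv => (hmem v).mp hv)]
      exact hfundQ)
  rw [Finset.sum_singleton] at h3
  exact h2.trans (add_le_add le_rfl h3)

end PlaceData

end Thm110StepII

end Literature.IUT.LogVolume

end
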